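import Summits.QuantumFields.BalabanUV.T4Continuum.Support.NE7StraightTowerCurlEnergy
import HarnessLib

/-!
# NE7LevelwiseTowerCurlEnergy — THE STRAIGHT TOWER's COARSE MAXWELL ENERGY WITH THE REMAINDER KEPT LEVEL-WISE (no reduction to the bottom mass):
# `√E_{j+1} ≤ √(L⁴∕L^d)^{j+1}·√E_0 + Σ_{i=0}^{j} √(L⁴∕L^d)^{j−i}·eC·x_i·√N_i`, `x_i = radIter i x` the level-`i` plaquette radius, `N_i` the HS mass of the level-`i` straight image
# `QbarIter L i W Y` over its period box (lineage `b2b-balaban-t4-ne7-p1`, gen 118, file G5; memo ROAD-G118 §3 — the form the HIERARCHICAL representative needs)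

Cell `pub-balaban`, rung (B)+1 sub-cell t4, CRUX PROVER NE7 #1 (OWNER of row NE7), generation 118.  Gen 117's F4 ✓ `NE7StraightTowerCurlEnergy.sqrt_curl_energy_QbarIter_le` collapses every
level's remainder `eC·x_i·√N_i` onto the BOTTOM mass `√N_0` through the one-step mass contraction (F3b), giving `towerB·√N_0` — the right currency for the multi-level slice representative
`X_♮ ∈ R₀v + T_♮(U, j+1)` (whose scaled bottom mass `η²N_0` is controlled by row NE3's k-free slice Poincaré; this gen's G2∕G4), but NOT for a HIERARCHICAL representative `X_h` (row NE7b's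
(H′): one-level slices at every level, hierarchically frame-free — the representative on which the MULTIPLIER term of the bordered Hessian is scale-correct, ✓ `NE7MultiplierTermHierFrameFree`),
whose level masses `N_i` are controlled level by level (one-level slice Poincaré at level `i`: `L^{−2}N_i ≲ C_P·E_i + …`) and whose radii `x_i ≈ ε·L^{−2(j+1−i)}` pair with them with room
`L` per level.  THIS FILE keeps the remainder LEVEL-WISE:
* §1 `towerRem d L ν N j W x Y` — the level-wise remainder, by the same bottom-peeling recursion as F4's `towerB` but WITHOUT the mass step:
  `towerRem 0 W x Y = eC·x·√N(Y; tower L N 1)`, `towerRem (j+1) W x Y = √(L⁴∕L^d)^{j+1}·eC·x·√N(Y; tower L N (j+2)) + towerRem j (cavg W) (prop1Radius x) (Qbar W Y)`;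
  `towerRem_nonneg`; **`towerRem_eq_sum`** — the closed form `Σ_{i<j+1} √(L⁴∕L^d)^{j−i}·eC·radIter i x·√(Σ_{b∈periodBox (tower L N (j+1−i))} Σ_κ nhsNormSq (QbarIter L i W Y b κ))`;
* §2 **`sqrt_curl_energy_QbarIter_le_levelwise`** — `√E_{j+1} ≤ √(L⁴∕L^d)^{j+1}·√E_0 + towerRem j W x Y` (induction peeling the bottom step, F3c's one-step energy letter ✓ `sqrt_energy_step` BY NAME);
* §3 **`towerRem_le_of_levels`** — monotone evaluation: displayed per-level bounds `eC·radIter i x·√N_i ≤ b i` (`i ≤ j`) give `towerRem ≤ Σ_{i<j+1} √(L⁴∕L^d)^{j−i}·b i` (in `d = 4`: `Σ_i b_i`).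
General `d`, every `U(n)`.
HONEST FRAMING: lattice kinematics of OUR averaging tower over landed kernel theorems; constants not optimised; nothing of Bałaban's asserted ([Balaban1985Averaging] (48) p.25, (120) p.35 context);
NOT (G′), NOT NE7 as a spine node, NOT NE3; spine 0∕9; finite T⁴ rung (B)+1 — NOT infinite volume, NOT mass gap, NOT BetaPertH, NOT Clay.
-/

set_option autoImplicit false

open scoped BigOperators Matrix.Norms.L2Operator
open NormedSpace Finset

namespace Summit.QuantumFields.BalabanUV.T4Continuum.NE7LevelwiseTowerCurlEnergy

open Literature.MathematicalPhysics.QuantumFieldTheory.Balaban1983to89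
open B7Prop1Explicit B7Prop2Explicit MatrixLog UnitaryModel
open T4AveragingDeficitWall (IsUnitaryCfg SmallField curl curlAt dirSq)
open T4AveragingDeficitWallBoundary (IsPeriodicCfg periodBox)
open AveragingDeficitPeriodicCounting (IsPeriodicDir)
open AveragingDeficitChartCalculus (cavg)
open AveragingDeficitTwoLevelPrep (twoLevelSmall prop1Radius)
open AveragingDeficitMultiLevelPrep (cavgIter tower LevelSmall radIter natCast_tower_succ tower_ne_zero prop1Radius_nonneg)
open AveragingDeficitFermat (isPeriodicCfg_cavg)
open MatrixNorms (nhsNormSq nhsNormSq_nonneg)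
open MinimalActionLevels (perWin)
open NE3TangentCovariantStructure (Qbar Qbar_add_period)
open NE3TangentCovariantTower (QbarIter QbarIter_succ QbarIter_one QbarIter_zero cavgIter_one cavgIter_succ step_small)
open NE7StraightTowerCurlEnergy (eC eC_nonneg sqrt_energy_step)

noncomputable section

variable {d : ℕ} {n : Type*} [Fintype n] [DecidableEq n]

/-! ## §1 The level-wise remainder -/

/-- **THE LEVEL-WISE TOWER REMAINDER** (bottom-peeling recursion, no mass step): `towerRem 0 W x Y = eC·x·√N(Y; tower L N 1)`,
`towerRem (j+1) W x Y = √(L⁴∕L^d)^{j+1}·eC·x·√N(Y; tower L N (j+2)) + towerRem j (cavg W) (prop1Radius x) (Qbar W Y)`. [folklore] -/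
def towerRem (d L : ℕ) (ν : ℝ) (N : ℕ) : ℕ → (Site d → Fin d → (Matrix n n ℂ)ˣ) → ℝ → (Site d → Fin d → Matrix n n ℂ) → ℝ
  | 0, _, x, Y => eC d L ν * x * Real.sqrt (∑ b ∈ periodBox (tower L N 1), ∑ κ : Fin d, nhsNormSq (Y b κ))
  | j + 1, W, x, Y => Real.sqrt ((L : ℝ) ^ 4 / (L : ℝ) ^ d) ^ (j + 1) * (eC d L ν * x) * Real.sqrt (∑ b ∈ periodBox (tower L N (j + 2)), ∑ κ : Fin d, nhsNormSq (Y b κ))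
      + towerRem d L ν N j (cavg L W) (prop1Radius d L x) (Qbar L W Y)

/-- `0 ≤ towerRem` for `0 ≤ x`. [folklore] -/
theorem towerRem_nonneg (d L : ℕ) {ν : ℝ} (N : ℕ) : ∀ (j : ℕ) (W : Site d → Fin d → (Matrix n n ℂ)ˣ) {x : ℝ} (Y : Site d → Fin d → Matrix n n ℂ), 0 ≤ x →
    0 ≤ towerRem d L ν N j W x Y
  | 0, _, _, _, hx => by
      unfold towerRem; have := eC_nonneg d L (ν := ν); positivity
  | j + 1, W, x, Y, hx => by
      unfold towerRem
      have := eC_nonneg d L (ν := ν)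
      have := towerRem_nonneg d L (ν := ν) N j (cavg L W) (Qbar L W Y) (prop1Radius_nonneg (d := d) (L := L) hx)
      positivity

/-- **THE CLOSED FORM**: `towerRem j W x Y = Σ_{i<j+1} √(L⁴∕L^d)^{j−i}·eC·radIter i x·√(Σ_{b∈periodBox (tower L N (j+1−i))} Σ_κ nhsNormSq (QbarIter L i W Y b κ))`. [folklore] -/
theorem towerRem_eq_sum (d L : ℕ) (ν : ℝ) (N : ℕ) : ∀ (j : ℕ) (W : Site d → Fin d → (Matrix n n ℂ)ˣ) (x : ℝ) (Y : Site d → Fin d → Matrix n n ℂ),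
    towerRem d L ν N j W x Y = ∑ i ∈ Finset.range (j + 1), Real.sqrt ((L : ℝ) ^ 4 / (L : ℝ) ^ d) ^ (j - i) * (eC d L ν * radIter d L i x)
        * Real.sqrt (∑ b ∈ periodBox (tower L N (j + 1 - i)), ∑ κ : Fin d, nhsNormSq (QbarIter L i W Y b κ))
  | 0, W, x, Y => by
      rw [Finset.sum_range_one]
      simp only [towerRem, radIter, QbarIter_zero, Nat.sub_zero, pow_zero, one_mul]
  | j + 1, W, x, Y => by
      rw [Finset.sum_range_succ', towerRem, towerRem_eq_sum d L ν N j (cavg L W) (prop1Radius d L x) (Qbar L W Y)]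
      simp only [radIter, QbarIter_zero, QbarIter_succ, Nat.sub_zero, Nat.add_sub_add_right]
      have e : ∀ i ∈ Finset.range (j + 1), Real.sqrt ((L : ℝ) ^ 4 / (L : ℝ) ^ d) ^ (j - i) * (eC d L ν * radIter d L i (prop1Radius d L x))
            * Real.sqrt (∑ b ∈ periodBox (tower L N (j + 1 - i)), ∑ κ : Fin d, nhsNormSq (QbarIter L i (cavg L W) (Qbar L W Y) b κ))
          = Real.sqrt ((L : ℝ) ^ 4 / (L : ℝ) ^ d) ^ (j + 1 - (i + 1)) * (eC d L ν * radIter d L i (prop1Radius d L x))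
            * Real.sqrt (∑ b ∈ periodBox (tower L N (j + 1 + 1 - (i + 1))), ∑ κ : Fin d, nhsNormSq (QbarIter L i (cavg L W) (Qbar L W Y) b κ)) := by
        intro i _
        have e1 : j + 1 - (i + 1) = j - i := Nat.add_sub_add_right j 1 i
        have e2 : j + 1 + 1 - (i + 1) = j + 1 - i := Nat.add_sub_add_right (j + 1) 1 i
        rw [e1, e2]
      rw [Finset.sum_congr rfl e]
      ring

/-! ## §2 The tower, level-wise -/

/-- **THE STRAIGHT TOWER's COARSE MAXWELL ENERGY, ALL LEVELS, ROOT FORM, LEVEL-WISE REMAINDER** (tower class: `W` unitary `(tower L N (j+1))`-periodic, `0 ≤ x`, `LevelSmall d L j x`,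
`SmallField W x`; `Y` `(tower L N (j+1))`-periodic):
`√(Σ_{P∈perWin N} nhsNormSq (curl (cavgIter L (j+1) W) (QbarIter L (j+1) W Y) P)) ≤ √(L⁴∕L^d)^{j+1}·√(Σ_{p∈perWin (tower L N (j+1))} nhsNormSq (curl W Y p)) + towerRem d L (card n) N j W x Y`.
[cite: Balaban1985Averaging, (48) p.25, (120) p.35] -/
theorem sqrt_curl_energy_QbarIter_le_levelwise [Nonempty n] {L N : ℕ} [NeZero L] (hL : 1 ≤ L) (hN : 1 ≤ N) :
    ∀ (j : ℕ) {W : Site d → Fin d → (Matrix n n ℂ)ˣ} {x : ℝ}, IsUnitaryCfg W → IsPeriodicCfg W ((tower L N (j + 1) : ℕ) : ℤ) → 0 ≤ x →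
    LevelSmall d L j x → SmallField W x →
    ∀ {Y : Site d → Fin d → Matrix n n ℂ}, IsPeriodicDir Y ((tower L N (j + 1) : ℕ) : ℤ) →
      Real.sqrt (∑ P ∈ perWin d N, nhsNormSq (curl (cavgIter L (j + 1) W) (QbarIter L (j + 1) W Y) P))
        ≤ Real.sqrt ((L : ℝ) ^ 4 / (L : ℝ) ^ d) ^ (j + 1) * Real.sqrt (∑ p ∈ perWin d (tower L N (j + 1)), nhsNormSq (curl W Y p))
          + towerRem d L (Fintype.card n) N j W x Y := by
  intro j
  induction j with
  | zero =>
      intro W x hWu hWP hx hsm hWx Y hYP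
      obtain ⟨h512, -, -, -⟩ := step_small hL hWu hx hsm.two hWx
      have e : ((tower L N (0 + 1) : ℕ) : ℤ) = (L : ℤ) * N := by rw [natCast_tower_succ]; rfl
      have hWP' : IsPeriodicCfg W ((L : ℤ) * N) := by rw [← e]; exact hWP
      have hYP' : IsPeriodicDir Y ((L : ℤ) * N) := by rw [← e]; exact hYP
      have h := sqrt_energy_step hL hN hWu hWP' hx h512 hWx hYP'
      rw [zero_add, pow_one, QbarIter_one, cavgIter_one]
      unfold towerRem
      have eT : L * N = tower L N 1 := by simp [tower]
      rw [eT] at h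
      exact h
  | succ j ih =>
      intro W x hWu hWP hx hsm hWx Y hYP
      obtain ⟨h512, hU', hx', hS'⟩ := step_small hL hWu hx hsm.1 hWx
      have hWP1 : IsPeriodicCfg W ((L : ℤ) * ((tower L N (j + 1) : ℕ) : ℤ)) := by rw [← natCast_tower_succ]; exact hWP
      have hYP1 : IsPeriodicDir Y ((L : ℤ) * ((tower L N (j + 1) : ℕ) : ℤ)) := by rw [← natCast_tower_succ]; exact hYP
      have hWP' : IsPeriodicCfg (cavg L W) ((tower L N (j + 1) : ℕ) : ℤ) := isPeriodicCfg_cavg L _ hWP1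
      have hYP' : IsPeriodicDir (Qbar L W Y) ((tower L N (j + 1) : ℕ) : ℤ) := fun z i κ => Qbar_add_period L hWP1 hYP1 z i κ
      have hT1 : 1 ≤ tower L N (j + 1) := Nat.one_le_iff_ne_zero.mpr (by
        haveI : NeZero N := ⟨by omega⟩
        exact tower_ne_zero L N (j + 1))
      have hih := ih hU' hWP' hx' hsm.2 hS' hYP'
      have hE := sqrt_energy_step hL hT1 hWu hWP1 hx h512 hWx hYP1
      have eT : L * tower L N (j + 1) = tower L N (j + 1 + 1) := rfl
      rw [eT] at hE
      rw [QbarIter_succ, cavgIter_succ]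
      refine hih.trans ?_
      set e₁ := Real.sqrt (∑ p ∈ perWin d (tower L N (j + 1)), nhsNormSq (curl (cavg L W) (Qbar L W Y) p)) with he₁
      set e₀ := Real.sqrt (∑ p ∈ perWin d (tower L N (j + 1 + 1)), nhsNormSq (curl W Y p)) with he₀
      set m₀ := Real.sqrt (∑ b ∈ periodBox (tower L N (j + 1 + 1)), ∑ κ : Fin d, nhsNormSq (Y b κ)) with hm₀
      set q : ℝ := Real.sqrt ((L : ℝ) ^ 4 / (L : ℝ) ^ d) with hq
      have hq0 : 0 ≤ q := Real.sqrt_nonneg _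
      calc q ^ (j + 1) * e₁ + towerRem d L (Fintype.card n) N j (cavg L W) (prop1Radius d L x) (Qbar L W Y)
          ≤ q ^ (j + 1) * (q * e₀ + eC d L (Fintype.card n) * x * m₀) + towerRem d L (Fintype.card n) N j (cavg L W) (prop1Radius d L x) (Qbar L W Y) :=
            add_le_add (mul_le_mul_of_nonneg_left hE (pow_nonneg hq0 _)) le_rfl
        _ = q ^ (j + 1 + 1) * e₀ + towerRem d L (Fintype.card n) N (j + 1) W x Y := by
            rw [towerRem]; ring

/-! ## §3 Monotone evaluation against displayed per-level bounds -/

/-- **LEVEL-WISE EVALUATION**: if `eC·radIter i x·√N_i ≤ b i` for every `i ≤ j` (`N_i` the HS mass of `QbarIter L i W Y` over `periodBox (tower L N (j+1−i))`), then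
`towerRem d L ν N j W x Y ≤ Σ_{i<j+1} √(L⁴∕L^d)^{j−i}·b i`. [folklore] -/
theorem towerRem_le_of_levels (d L : ℕ) (ν : ℝ) (N : ℕ) (j : ℕ) (W : Site d → Fin d → (Matrix n n ℂ)ˣ) (x : ℝ) (Y : Site d → Fin d → Matrix n n ℂ)
    {b : ℕ → ℝ} (hb : ∀ i ≤ j, eC d L ν * radIter d L i x * Real.sqrt (∑ b ∈ periodBox (tower L N (j + 1 - i)), ∑ κ : Fin d, nhsNormSq (QbarIter L i W Y b κ)) ≤ b i) :
    towerRem d L ν N j W x Y ≤ ∑ i ∈ Finset.range (j + 1), Real.sqrt ((L : ℝ) ^ 4 / (L : ℝ) ^ d) ^ (j - i) * b i := by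
  rw [towerRem_eq_sum]
  refine Finset.sum_le_sum fun i hi => ?_
  have hij : i ≤ j := Nat.lt_succ_iff.mp (Finset.mem_range.mp hi)
  have hq : 0 ≤ Real.sqrt ((L : ℝ) ^ 4 / (L : ℝ) ^ d) ^ (j - i) := pow_nonneg (Real.sqrt_nonneg _) _
  calc Real.sqrt ((L : ℝ) ^ 4 / (L : ℝ) ^ d) ^ (j - i) * (eC d L ν * radIter d L i x)
        * Real.sqrt (∑ b ∈ periodBox (tower L N (j + 1 - i)), ∑ κ : Fin d, nhsNormSq (QbarIter L i W Y b κ))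
      = Real.sqrt ((L : ℝ) ^ 4 / (L : ℝ) ^ d) ^ (j - i)
          * (eC d L ν * radIter d L i x * Real.sqrt (∑ b ∈ periodBox (tower L N (j + 1 - i)), ∑ κ : Fin d, nhsNormSq (QbarIter L i W Y b κ))) := by ring
    _ ≤ Real.sqrt ((L : ℝ) ^ 4 / (L : ℝ) ^ d) ^ (j - i) * b i := mul_le_mul_of_nonneg_left (hb i hij) hq

/-- **IN `d = 4` THE WEIGHTS ARE ONE**: `towerRem 4 L ν N j W x Y ≤ Σ_{i<j+1} b i` under the same per-level bounds (`L ≥ 1`). [folklore] -/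
theorem towerRem_le_of_levels_d4 {L : ℕ} (hL : 1 ≤ L) (ν : ℝ) (N : ℕ) (j : ℕ) (W : Site 4 → Fin 4 → (Matrix n n ℂ)ˣ) (x : ℝ) (Y : Site 4 → Fin 4 → Matrix n n ℂ)
    {b : ℕ → ℝ} (hb : ∀ i ≤ j, eC 4 L ν * radIter 4 L i x * Real.sqrt (∑ b ∈ periodBox (tower L N (j + 1 - i)), ∑ κ : Fin 4, nhsNormSq (QbarIter L i W Y b κ)) ≤ b i) :
    towerRem 4 L ν N j W x Y ≤ ∑ i ∈ Finset.range (j + 1), b i := by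
  have h := towerRem_le_of_levels 4 L ν N j W x Y hb
  have hL0 : (0 : ℝ) < L := by exact_mod_cast (show 0 < L by omega)
  have e : Real.sqrt ((L : ℝ) ^ 4 / (L : ℝ) ^ 4) = 1 := by rw [div_self (by positivity), Real.sqrt_one]
  simp only [e, one_pow, one_mul] at h
  exact h

end

end Summit.QuantumFields.BalabanUV.T4Continuum.NE7LevelwiseTowerCurlEnergy
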